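import Mathlib.MeasureTheory.Function.LpSeminorm.Basic
import Mathlib.MeasureTheory.Measure.Lebesgue.Basic
import Mathlib.Analysis.SpecialFunctions.Pow.Integral
import HarnessLib

/-!
# Lorentz `L^{p,1}` membership (the distribution-function form)

Analysis/FunctionSpaces definition file, companion of `WeakLp.lean` (`L^{p,∞}`). The **Lorentz
space** `L^{p,1}(μ)`, `0 < p < ∞`, consists of the (a.e.-strongly) measurable `f` whose
distribution function `d_f(t) = μ{x : |f(x)| > t}` satisfies `∫₀^∞ d_f(t)^{1/p} dt < ∞`:
by Grafakos, *Classical Fourier Analysis*, 3rd ed., Prop. 1.4.9, the Lorentz quasinorm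
`‖f‖_{L^{p,q}} = (∫₀^∞ (t^{1/p} f*(t))^q dt/t)^{1/q}` (Def. 1.4.6, `f*` the decreasing
rearrangement) equals `p^{1/q} (∫₀^∞ (d_f(s)^{1/p} s)^q ds/s)^{1/q}`, which for `q = 1` reads
`‖f‖_{L^{p,1}} = p ∫₀^∞ d_f(s)^{1/p} ds`. So `f ∈ L^{p,1}` iff the integral below is finite; we
use the distribution-function form because Mathlib has no decreasing rearrangement. `L^{p,1}` is
the smallest of the Lorentz scale `L^{p,1} ⊂ L^{p,q} ⊂ L^p = L^{p,p} ⊂ L^{p,∞}` (Grafakos,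
Prop. 1.4.10). It is vendored for the time-Lorentz Serrin class `L^{q,1}(0,T; L^p(ℝ³))` of
Wang–Wu–Zhang (Ann. Inst. H. Poincaré C (2023), Thm. 1.1: one velocity component
`u₃ ∈ L^{q,1}_t L^p_x`, `2/q + 3/p ≤ 1` — "`L^{q,1}` denotes the Lorentz space with respect to
the variable `t`"; their (3.x) use exactly the atomic/distributional description), see
`Literature/Analysis/FluidPDE/WangWuZhangOneComponentLorentzSerrin.lean`.

This file defines
* `eLorentzOneNorm f p μ = ∫⁻ t ∈ (0,∞), μ{x | t < ‖f x‖}^{1/p} dt` — `p⁻¹` times the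
  `L^{p,1}` quasinorm of Grafakos' normalisation, valued in `ℝ≥0∞` (exponent through `p.toReal`
  as in `MeasureTheory.eLpNorm`; for `p ∈ {0, ∞}` the exponent `1/p.toReal` is the junk `0`, the
  integrand is `1` and the value is `∞` — nothing is in "`L^{0,1}`"/"`L^{∞,1}`", consistent with
  `L^{∞,q} = {0}` for `q < ∞`);
* `MemLorentzOne f p μ` — `f ∈ L^{p,1}(μ)`: a.e.-strongly measurable with finite `eLorentzOneNorm`;
and proves: unfolding, `0 ∈ L^{p,1}` for `0 < p < ∞`, and the level inequality
`t · d_f(t)^{1/p} ≤ eLorentzOneNorm f p μ` (`d_f` is non-increasing, so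
`t d_f(t)^{1/p} ≤ ∫₀ᵗ d_f(s)^{1/p} ds`) — the pointwise form of `L^{p,1} ⊂ L^{p,∞}`
(Grafakos, Prop. 1.4.10), which also shows the definition is not vacuous in the other direction
(every level set of a member has finite measure).

## Mathlib / tree search

Mathlib: `MeasureTheory.eLpNorm`/`MemLp` (strong spaces), layer-cake formulas
(`MeasureTheory.lintegral_rpow_eq_lintegral_meas_lt_mul`), no Lorentz spaces and no decreasing
rearrangement (searched `Lorentz|rearrangement|distribution` under `Mathlib/MeasureTheory`). Tree:
`Literature.Analysis.FunctionSpaces.eWeakLpPow` / `MemWeakLp` (`L^{p,∞}`, `WeakLp.lean`), whose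
conventions (sets `{x | t < ‖f x‖ₑ}`, exponent via `toReal`) this file copies; nothing for `L^{p,1}`
(`lean search 'Lorentz'`: Lorentz gas / group only).

## References

* L. Grafakos, *Classical Fourier Analysis*, 3rd ed., GTM 249 (2014), §1.4.2: Def. 1.4.6,
  Prop. 1.4.9 (distribution-function formula), Prop. 1.4.10 (nesting). [Grafakos2014]
* W. Wang, D. Wu, Z. Zhang, Ann. Inst. H. Poincaré Anal. Non Linéaire (2023),
  doi:10.4171/aihpc/77, Thm. 1.1 (the class `L^{q,1}(0,T; L^p)`). [WangWuZhang2023]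
-/

noncomputable section

open MeasureTheory Set Function Filter
open scoped ENNReal NNReal Topology

namespace Literature.Analysis.FunctionSpaces

variable {α : Type*} [MeasurableSpace α] {E : Type*} [NormedAddCommGroup E]

/-- The **Lorentz `L^{p,1}` functional** in distribution-function form,
`eLorentzOneNorm f p μ = ∫₀^∞ μ{x | t < ‖f x‖}^{1/p} dt` (`= p⁻¹ ‖f‖_{L^{p,1}}` in the
normalisation of Grafakos, Prop. 1.4.9: `‖f‖_{L^{p,1}} = p ∫₀^∞ d_f(s)^{1/p} ds`). The exponent
enters through `p.toReal`; for `p = 0` or `p = ∞` the value is the junk `∞ · 1 = ∞`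
(documented in the module docstring). [cite: Grafakos2014, Prop. 1.4.9 (q = 1)] -/
def eLorentzOneNorm (f : α → E) (p : ℝ≥0∞) (μ : Measure α) : ℝ≥0∞ :=
  ∫⁻ t in Ioi (0 : ℝ), μ {x | ENNReal.ofReal t < ‖f x‖ₑ} ^ (1 / p.toReal)

/-- **Lorentz `L^{p,1}` membership**, `f ∈ L^{p,1}(μ)`: `f` is a.e.-strongly measurable and
`∫₀^∞ μ{|f| > t}^{1/p} dt < ∞` (Grafakos, Def. 1.4.6 with Prop. 1.4.9). [cite: Grafakos2014, Def. 1.4.6 and Prop. 1.4.9] -/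
def MemLorentzOne (f : α → E) (p : ℝ≥0∞) (μ : Measure α) : Prop :=
  AEStronglyMeasurable f μ ∧ eLorentzOneNorm f p μ < ∞

variable {f : α → E} {p : ℝ≥0∞} {μ : Measure α}

/-- Unfolding lemma for `eLorentzOneNorm` (the distribution-function form of Grafakos,
Prop. 1.4.9 at `q = 1`). [cite: Grafakos2014, Prop. 1.4.9 (q = 1)] -/
theorem eLorentzOneNorm_def (f : α → E) (p : ℝ≥0∞) (μ : Measure α) :
    eLorentzOneNorm f p μ =
      ∫⁻ t in Ioi (0 : ℝ), μ {x | ENNReal.ofReal t < ‖f x‖ₑ} ^ (1 / p.toReal) :=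
  rfl

/-- Unfolding lemma for `MemLorentzOne` (Grafakos, Def. 1.4.6 read through Prop. 1.4.9). [cite: Grafakos2014, Def. 1.4.6 and Prop. 1.4.9] -/
theorem memLorentzOne_iff :
    MemLorentzOne f p μ ↔ AEStronglyMeasurable f μ ∧ eLorentzOneNorm f p μ < ∞ :=
  Iff.rfl

/-- A member of `L^{p,1}` is a.e.-strongly measurable (by definition; Grafakos, Def. 1.4.6:
"`f` a measurable function"). [cite: Grafakos2014, Def. 1.4.6] -/
theorem MemLorentzOne.aestronglyMeasurable (h : MemLorentzOne f p μ) :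
    AEStronglyMeasurable f μ :=
  h.1

/-- A member of `L^{p,1}` has finite Lorentz functional (by definition; Grafakos, Def. 1.4.6:
"the set of all `f` with `‖f‖_{L^{p,q}} < ∞`"). [cite: Grafakos2014, Def. 1.4.6] -/
theorem MemLorentzOne.eLorentzOneNorm_lt_top (h : MemLorentzOne f p μ) :
    eLorentzOneNorm f p μ < ∞ :=
  h.2

/-- The zero function has zero Lorentz functional for `0 < p < ∞` (all its superlevel sets
`{t < ‖0‖}`, `t > 0`, are empty and `0^{1/p} = 0`; Grafakos, Def. 1.4.6: `L^{p,q}` is a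
quasi-normed linear space, `‖0‖ = 0`). [cite: Grafakos2014, Def. 1.4.6] -/
theorem eLorentzOneNorm_zero (hp : 0 < p.toReal) : eLorentzOneNorm (0 : α → E) p μ = 0 := by
  have hset : ∀ t : ℝ, {x : α | ENNReal.ofReal t < ‖(0 : α → E) x‖ₑ} = ∅ := by
    intro t
    ext x
    simp
  unfold eLorentzOneNorm
  simp_rw [hset, measure_empty, ENNReal.zero_rpow_of_pos (by positivity : (0 : ℝ) < 1 / p.toReal),
    lintegral_zero]

/-- `0 ∈ L^{p,1}` for `0 < p < ∞` (Grafakos, Def. 1.4.6: a linear space). [cite: Grafakos2014, Def. 1.4.6] -/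
theorem memLorentzOne_zero (hp0 : p ≠ 0) (hptop : p ≠ ∞) : MemLorentzOne (0 : α → E) p μ :=
  ⟨aestronglyMeasurable_const, by
    rw [eLorentzOneNorm_zero (ENNReal.toReal_pos hp0 hptop)]
    exact ENNReal.zero_lt_top⟩

/-- **The level inequality** `t · μ{t < ‖f‖}^{1/p} ≤ eLorentzOneNorm f p μ` for `t ≥ 0`: the
distribution function is non-increasing, so `t d_f(t)^{1/p} = ∫₀ᵗ d_f(t)^{1/p} ds ≤
∫₀ᵗ d_f(s)^{1/p} ds ≤ ∫₀^∞ d_f(s)^{1/p} ds` — the pointwise form of the embedding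
`L^{p,1} ⊂ L^{p,∞}` (Grafakos, Prop. 1.4.10). [cite: Grafakos2014, Prop. 1.4.10] -/
theorem ofReal_mul_meas_rpow_le_eLorentzOneNorm (f : α → E) (p : ℝ≥0∞) (μ : Measure α)
    (t : ℝ) :
    ENNReal.ofReal t * μ {x | ENNReal.ofReal t < ‖f x‖ₑ} ^ (1 / p.toReal) ≤
      eLorentzOneNorm f p μ := by
  have hsub : Ioc 0 t ⊆ Ioi 0 := fun s hs => hs.1
  calc ENNReal.ofReal t * μ {x | ENNReal.ofReal t < ‖f x‖ₑ} ^ (1 / p.toReal)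
      = ∫⁻ _ in Ioc 0 t, μ {x | ENNReal.ofReal t < ‖f x‖ₑ} ^ (1 / p.toReal) := by
        rw [setLIntegral_const, Real.volume_Ioc, sub_zero, mul_comm]
    _ ≤ ∫⁻ s in Ioc 0 t, μ {x | ENNReal.ofReal s < ‖f x‖ₑ} ^ (1 / p.toReal) := by
        refine setLIntegral_mono' measurableSet_Ioc fun s hs => ?_
        refine ENNReal.rpow_le_rpow (measure_mono fun x hx => ?_) (by positivity)
        exact lt_of_le_of_lt (ENNReal.ofReal_le_ofReal hs.2) hx
    _ ≤ eLorentzOneNorm f p μ := lintegral_mono_set hsub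

/-- Consequently every positive level set of a member of `L^{p,1}` has finite measure
(`0 < p < ∞`, `t > 0`) — `L^{p,1} ⊂ L^{p,∞}` (Grafakos, Prop. 1.4.10) and members of weak `L^p`
have `d_f(t) ≤ t^{-p}‖f‖^p_{L^{p,∞}} < ∞` (Def. 1.1.5). [cite: Grafakos2014, Prop. 1.4.10 with Def. 1.1.5] -/
theorem MemLorentzOne.meas_lt_top (h : MemLorentzOne f p μ) (hp0 : p ≠ 0) (hptop : p ≠ ∞)
    {t : ℝ} (ht : 0 < t) : μ {x | ENNReal.ofReal t < ‖f x‖ₑ} < ∞ := by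
  have hexp : 0 < 1 / p.toReal := by
    have := ENNReal.toReal_pos hp0 hptop
    positivity
  have hfin : ENNReal.ofReal t * μ {x | ENNReal.ofReal t < ‖f x‖ₑ} ^ (1 / p.toReal) < ∞ :=
    lt_of_le_of_lt (ofReal_mul_meas_rpow_le_eLorentzOneNorm f p μ t) h.2
  by_contra hcon
  rw [not_lt, top_le_iff] at hcon
  rw [hcon, ENNReal.top_rpow_of_pos hexp, ENNReal.mul_top (ENNReal.ofReal_pos.2 ht).ne'] at hfin
  exact lt_irrefl _ hfin

/-! ### The embedding `L^{p,1} ⊂ L^p` (Grafakos, Prop. 1.4.10 with `r = p`, `L^{p,p} = L^p`) -/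

omit [MeasurableSpace α] in
/-- For `t > 0` the real and the extended superlevel sets agree:
`{x | ofReal t < ‖f x‖ₑ} = {x | t < ‖f x‖}`. [cite: Grafakos2014, Def. 1.1.1 (distribution function)] -/
theorem setOf_ofReal_lt_enorm_eq (f : α → E) {t : ℝ} (ht : 0 ≤ t) :
    {x | ENNReal.ofReal t < ‖f x‖ₑ} = {x | t < ‖f x‖} := by
  ext x
  simp only [mem_setOf_eq]
  rw [← ofReal_norm, ENNReal.ofReal_lt_ofReal_iff_of_nonneg ht]

/-- **Layer-cake bound by the Lorentz functional** (the computation behind Grafakos, Prop. 1.4.10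
for `(q, r) = (1, p)`): for `1 ≤ p < ∞` and a.e.-strongly measurable `f`,
`∫ ‖f‖^p dμ ≤ p · (eLorentzOneNorm f p μ)^p`. Proof: `∫‖f‖^p = p ∫₀^∞ t^{p−1} d_f(t) dt`
(layer cake) and `t^{p−1} d_f(t) = (t d_f(t)^{1/p})^{p−1} d_f(t)^{1/p} ≤ A^{p−1} d_f(t)^{1/p}` by
the level inequality `t d_f(t)^{1/p} ≤ A = ∫₀^∞ d_f^{1/p}`. [cite: Grafakos2014, Prop. 1.4.10 (proof, case r = p)] -/
theorem lintegral_rpow_enorm_le_mul_eLorentzOneNorm_rpow (hf : AEStronglyMeasurable f μ)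
    (hp1 : 1 ≤ p) (hptop : p ≠ ∞) :
    ∫⁻ x, ‖f x‖ₑ ^ p.toReal ∂μ ≤
      ENNReal.ofReal p.toReal * eLorentzOneNorm f p μ ^ p.toReal := by
  set q : ℝ := p.toReal with hq_def
  have hq1 : 1 ≤ q := by
    have h := ENNReal.toReal_mono hptop hp1
    simpa using h
  have hq : 0 < q := lt_of_lt_of_le zero_lt_one hq1
  have hq1' : 0 ≤ q - 1 := by linarith
  set A : ℝ≥0∞ := eLorentzOneNorm f p μ with hA_def
  -- the case `A = ∞` is trivial
  by_cases hA : A = ∞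
  · rw [hA, ENNReal.top_rpow_of_pos hq, ENNReal.mul_top (by simpa using hq)]
    exact le_top
  -- layer cake for the real function `‖f ·‖`
  have hnn : 0 ≤ᵐ[μ] fun x => ‖f x‖ := Eventually.of_forall fun x => norm_nonneg _
  have hmeas : AEMeasurable (fun x => ‖f x‖) μ := hf.norm.aemeasurable
  have hcake := lintegral_rpow_eq_lintegral_meas_lt_mul μ hnn hmeas hq
  have hlhs : ∫⁻ x, ‖f x‖ₑ ^ q ∂μ = ∫⁻ x, ENNReal.ofReal (‖f x‖ ^ q) ∂μ := by
    refine lintegral_congr fun x => ?_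
    rw [← ENNReal.ofReal_rpow_of_nonneg (norm_nonneg _) hq.le, ofReal_norm]
  rw [hlhs, hcake]
  -- pointwise bound of the layer-cake integrand on `(0, ∞)`
  have hpt : ∀ t ∈ Ioi (0 : ℝ),
      μ {a | t < ‖f a‖} * ENNReal.ofReal (t ^ (q - 1)) ≤
        A ^ (q - 1) * μ {x | ENNReal.ofReal t < ‖f x‖ₑ} ^ (1 / q) := by
    intro t ht
    have ht0 : 0 ≤ t := le_of_lt ht
    rw [← setOf_ofReal_lt_enorm_eq f ht0]
    set d : ℝ≥0∞ := μ {x | ENNReal.ofReal t < ‖f x‖ₑ} with hd_def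
    have key : d ^ (1 / q) * ENNReal.ofReal t ≤ A := by
      rw [mul_comm]
      exact ofReal_mul_meas_rpow_le_eLorentzOneNorm f p μ t
    have hd : d = (d ^ (1 / q)) ^ q := by
      rw [← ENNReal.rpow_mul, one_div_mul_cancel hq.ne', ENNReal.rpow_one]
    have hsplit : (d ^ (1 / q)) ^ q = d ^ (1 / q) * (d ^ (1 / q)) ^ (q - 1) := by
      have h1 : (d ^ (1 / q)) ^ q = (d ^ (1 / q)) ^ (1 + (q - 1)) := by
        congr 1
        ring
      rw [h1, ENNReal.rpow_add_of_nonneg _ _ zero_le_one hq1', ENNReal.rpow_one]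
    have ht' : ENNReal.ofReal (t ^ (q - 1)) = (ENNReal.ofReal t) ^ (q - 1) :=
      (ENNReal.ofReal_rpow_of_nonneg ht0 hq1').symm
    calc d * ENNReal.ofReal (t ^ (q - 1))
        = d ^ (1 / q) * ((d ^ (1 / q)) ^ (q - 1) * (ENNReal.ofReal t) ^ (q - 1)) := by
          rw [ht']
          conv_lhs => rw [hd, hsplit]
          rw [mul_assoc]
      _ = d ^ (1 / q) * (d ^ (1 / q) * ENNReal.ofReal t) ^ (q - 1) := by
          rw [ENNReal.mul_rpow_of_nonneg _ _ hq1']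
      _ ≤ d ^ (1 / q) * A ^ (q - 1) :=
          mul_le_mul' le_rfl (ENNReal.rpow_le_rpow key hq1')
      _ = A ^ (q - 1) * d ^ (1 / q) := mul_comm _ _
  have hint : ∫⁻ t in Ioi (0 : ℝ), μ {a | t < ‖f a‖} * ENNReal.ofReal (t ^ (q - 1)) ≤
      A ^ (q - 1) * A := by
    calc ∫⁻ t in Ioi (0 : ℝ), μ {a | t < ‖f a‖} * ENNReal.ofReal (t ^ (q - 1))
        ≤ ∫⁻ t in Ioi (0 : ℝ), A ^ (q - 1) * μ {x | ENNReal.ofReal t < ‖f x‖ₑ} ^ (1 / q) :=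
          setLIntegral_mono' measurableSet_Ioi hpt
      _ = A ^ (q - 1) * ∫⁻ t in Ioi (0 : ℝ), μ {x | ENNReal.ofReal t < ‖f x‖ₑ} ^ (1 / q) := by
          rw [lintegral_const_mul' _ _ (ENNReal.rpow_ne_top_of_nonneg hq1' hA)]
      _ = A ^ (q - 1) * A := by rfl
  have hAq : A ^ (q - 1) * A = A ^ q := by
    have h1 : A ^ q = A ^ ((q - 1) + 1) := by
      congr 1
      ring
    rw [h1, ENNReal.rpow_add_of_nonneg _ _ hq1' zero_le_one, ENNReal.rpow_one]
  calc ENNReal.ofReal q * ∫⁻ t in Ioi (0 : ℝ), μ {a | t < ‖f a‖} * ENNReal.ofReal (t ^ (q - 1))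
      ≤ ENNReal.ofReal q * (A ^ (q - 1) * A) := by gcongr
    _ = ENNReal.ofReal q * A ^ q := by rw [hAq]

/-- **`L^{p,1} ⊂ L^p` with constant** (Grafakos, Prop. 1.4.10, `r = p`): for `1 ≤ p < ∞`,
`‖f‖_{L^p} ≤ p^{1/p} · eLorentzOneNorm f p μ` (`= p^{1/p − 1}‖f‖_{L^{p,1}}` in Grafakos'
normalisation). [cite: Grafakos2014, Prop. 1.4.10 (r = p)] -/
theorem eLpNorm_le_mul_eLorentzOneNorm (hf : AEStronglyMeasurable f μ) (hp1 : 1 ≤ p)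
    (hptop : p ≠ ∞) :
    eLpNorm f p μ ≤
      ENNReal.ofReal p.toReal ^ (1 / p.toReal) * eLorentzOneNorm f p μ := by
  have hp0 : p ≠ 0 := (lt_of_lt_of_le zero_lt_one hp1).ne'
  have hq : 0 < p.toReal := ENNReal.toReal_pos hp0 hptop
  rw [eLpNorm_eq_lintegral_rpow_enorm_toReal hp0 hptop]
  calc (∫⁻ x, ‖f x‖ₑ ^ p.toReal ∂μ) ^ (1 / p.toReal)
      ≤ (ENNReal.ofReal p.toReal * eLorentzOneNorm f p μ ^ p.toReal) ^ (1 / p.toReal) :=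
        ENNReal.rpow_le_rpow (lintegral_rpow_enorm_le_mul_eLorentzOneNorm_rpow hf hp1 hptop)
          (by positivity)
    _ = ENNReal.ofReal p.toReal ^ (1 / p.toReal) *
          (eLorentzOneNorm f p μ ^ p.toReal) ^ (1 / p.toReal) :=
        ENNReal.mul_rpow_of_nonneg _ _ (by positivity)
    _ = ENNReal.ofReal p.toReal ^ (1 / p.toReal) * eLorentzOneNorm f p μ := by
        rw [← ENNReal.rpow_mul, mul_one_div_cancel hq.ne', ENNReal.rpow_one]

/-- **`L^{p,1}(μ) ⊂ L^p(μ)`** for `1 ≤ p < ∞` (Grafakos, Prop. 1.4.10: `L^{p,q} ⊂ L^{p,r}` for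
`q < r`, here `(q, r) = (1, p)` and `L^{p,p} = L^p`). [cite: Grafakos2014, Prop. 1.4.10] -/
theorem MemLorentzOne.memLp (h : MemLorentzOne f p μ) (hp1 : 1 ≤ p) (hptop : p ≠ ∞) :
    MemLp f p μ := by
  refine ⟨h.1, lt_of_le_of_lt (eLpNorm_le_mul_eLorentzOneNorm h.1 hp1 hptop) ?_⟩
  exact ENNReal.mul_lt_top (ENNReal.rpow_lt_top_of_nonneg (by positivity) ENNReal.ofReal_ne_top)
    h.2

end Literature.Analysis.FunctionSpaces

end
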